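import Mathlib.NumberTheory.LSeries.Deriv
import Mathlib.NumberTheory.LSeries.Injectivity
import Mathlib.Analysis.Complex.Convex
import Literature.NumberTheory.LFunctions.GaussianHeckeThetaMellin
import Literature.NumberTheory.LFunctions.GaussianHeckeVonMangoldt
import HarnessLib

/-!
# The Hecke `L`-functions of `ℚ(i)` as `L`-series: `-D_m' = D_m P_m` and `D_m = 4 e^{Q_m}`

Topic `Literature/NumberTheory/LFunctions`.  Fourth brick of the proof of Hecke's theorem on
Gaussian primes in sectors (`Literature.NumberTheory.LFunctions.GaussianInt.hecke_gaussianPrimes_inSectors`),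
joining the analytic continuation `heckeL m` of `D_m(s) = ∑_{z ≠ 0} λ^m(z) N(z)^{-s}`
(`GaussianHeckeThetaMellin.lean`) with the arithmetic of `GaussianHeckeVonMangoldt.lean`.
Everything is PROVED; no named facts.

* `LSeriesHasSum_cCoeff`: for `Re s > 1`, `D_m(s) = ∑_{n ≥ 1} c_m(n) n^{-s}` is the `L`-series of
  `c_m(n) = ∑_{N(x) = n} λ^m(x)`; abscissa of absolute convergence `≤ 1` (`abscissa_cCoeff_le`);
* `heckeP m s = ∑_n l_m(n) n^{-s} = ∑_{π, j ≥ 1} log N(π) λ^m(π)^j N(π)^{-js}` (first-quadrant primes)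
  and `heckeQ m s = ∑_{π, j} j⁻¹ λ^m(π)^j N(π)^{-js}`, both absolutely convergent for `Re s > 1`
  (`abscissa_lCoeff_le`, `abscissa_qCoeff_le`), with `Q_m' = -P_m` (`deriv_heckeQ`);
* **`D_m'(s) = -D_m(s) P_m(s)`** for `Re s > 1` (`deriv_heckeL`, from `convolution_cCoeff_lCoeff`);
* **`D_m(s) = 4 exp(Q_m(s))`** for `Re s > 1` (`heckeL_eq_four_mul_exp`: `D_m e^{-Q_m}` has zero
  derivative on the half-plane and tends to `c_m(1) = 4` as `s → +∞`) — the Euler product in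
  logarithmic form; hence **`D_m(s) ≠ 0` for `Re s > 1`** (`heckeL_ne_zero_of_one_lt_re`) and
  `P_m = -D_m'/D_m` (`heckeP_eq_neg_deriv_div`).

## References

* E. Hecke, *Eine neue Art von Zetafunktionen und ihre Beziehungen zur Verteilung der
  Primzahlen. II*, Math. Z. 6 (1920), 11–51, §7. [HeckeMathZ1920]
-/

noncomputable section

open Complex Filter Topology Finset LSeries

namespace Literature.NumberTheory.LFunctions

namespace GaussianHecke

open GaussianInt GaussianTheta
open Literature.NumberTheory.QuadraticFields.GaussianPrimary (norm_pow')

local notation "ℤ[i]" => _root_.GaussianInt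

open scoped Classical

/-- `N(z)` as a real number through `natAbs`: `((N z).natAbs : ℝ) = N z`. [folklore] -/
theorem natAbs_norm_real (z : ℤ[i]) : ((z.norm.natAbs : ℕ) : ℝ) = (z.norm : ℝ) := by
  rw [Nat.cast_natAbs, abs_of_nonneg (by exact_mod_cast GaussianInt.norm_nonneg z)]

/-! ### `D_m` as the `L`-series of `c_m` -/

/-- The summand of `D_m(s)` over `ℤ[i]`: `[x ≠ 0] λ^m(x) N(x)^{-s}`. [folklore] -/
def dTerm (m : ℕ) (s : ℂ) (x : ℤ[i]) : ℂ :=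
  if x = 0 then 0 else angularChar m x / (((x.norm : ℝ)) : ℂ) ^ s

/-- The fibre of the norm map over `n` is `normEq n`. [folklore] -/
theorem norm_fiber_eq (n : ℕ) : ((fun x : ℤ[i] ↦ x.norm.natAbs) ⁻¹' {n}) = ↑(normEq n) := by
  ext x
  simp only [Set.mem_preimage, Set.mem_singleton_iff, Finset.mem_coe, mem_normEq]
  have := GaussianInt.norm_nonneg x
  omega

/-- Summing `[x ≠ 0] λ^m(x) N(x)^{-s}` over the Gaussian integers of norm `n` gives the `n`-th term
`c_m(n) n^{-s}` of the `L`-series of `c_m`. [folklore] -/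
theorem sum_normEq_dTerm (m : ℕ) (s : ℂ) (n : ℕ) :
    ∑ x ∈ normEq n, dTerm m s x = term (cCoeff m) s n := by
  rcases eq_or_ne n 0 with rfl | hn
  · rw [normEq_zero, sum_singleton, term_zero, dTerm, if_pos rfl]
  · rw [term_of_ne_zero hn, cCoeff, sum_div]
    refine sum_congr rfl fun x hx ↦ ?_
    rw [mem_normEq] at hx
    have hx0 : x ≠ 0 := by
      rw [← GaussianInt.norm_eq_zero.ne, hx]; exact_mod_cast hn
    rw [dTerm, if_neg hx0, hx]
    norm_cast

/-- **`D_m(s) = ∑_n c_m(n) n^{-s}` for `Re s > 1`.** [cite: HeckeMathZ1920, §7] -/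
theorem LSeriesHasSum_cCoeff (m : ℕ) {s : ℂ} (hs : 1 < s.re) :
    LSeriesHasSum (cCoeff m) s (heckeL m s) := by
  have h := (hasSum_heckeL m hs).tsum_fiberwise fun x : ℤ[i] ↦ x.norm.natAbs
  refine h.congr_fun fun n ↦ ?_
  show term (cCoeff m) s n = ∑' x : ↑((fun x : ℤ[i] ↦ x.norm.natAbs) ⁻¹' {n}), dTerm m s x
  rw [tsum_congr_set_coe (dTerm m s) (norm_fiber_eq n), Finset.tsum_subtype' (normEq n) (dTerm m s)]
  exact (sum_normEq_dTerm m s n).symm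

/-- `‖term c_m s n‖ ≤ ∑_{N(x) = n} ‖[x ≠ 0] N(x)^{-s}‖`. [folklore] -/
theorem norm_term_cCoeff_le (m : ℕ) (s : ℂ) (n : ℕ) :
    ‖term (cCoeff m) s n‖ ≤ ∑ x ∈ normEq n, ‖dTerm 0 s x‖ := by
  rw [← sum_normEq_dTerm]
  refine (norm_sum_le _ _).trans (sum_le_sum fun x _ ↦ ?_)
  unfold dTerm
  split_ifs with hx
  · simp
  · rw [norm_div, norm_div, norm_angularChar hx, angularChar_zero_left, norm_one]

/-- The `L`-series of `c_m` converges absolutely for `Re s > 1`. [folklore] -/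
theorem LSeriesSummable_cCoeff (m : ℕ) {s : ℂ} (hs : 1 < s.re) : LSeriesSummable (cCoeff m) s := by
  -- the majorant family `‖[x ≠ 0] N(x)^{-s}‖ = N(x)^{-σ}` is summable over `ℤ[i]`
  have hmaj : Summable fun x : ℤ[i] ↦ ‖dTerm 0 s x‖ := by
    refine (GaussianTheta.summable_norm_rpow_neg hs).congr fun x ↦ ?_
    unfold dTerm
    split_ifs with hx
    · subst hx
      rw [norm_zero, Zsqrtd.norm_zero, Int.cast_zero, Real.zero_rpow (by linarith)]
    · have hN : (0 : ℝ) < (x.norm : ℝ) := by exact_mod_cast GaussianInt.norm_pos.mpr hx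
      rw [norm_div, angularChar_zero_left, norm_one, Complex.norm_cpow_eq_rpow_re_of_pos hN,
        Real.rpow_neg hN.le, one_div]
  have hfib := hmaj.hasSum.tsum_fiberwise fun x : ℤ[i] ↦ x.norm.natAbs
  refine Summable.of_norm_bounded hfib.summable fun n ↦ ?_
  rw [tsum_congr_set_coe (fun x ↦ ‖dTerm 0 s x‖) (norm_fiber_eq n),
    Finset.tsum_subtype' (normEq n) (fun x ↦ ‖dTerm 0 s x‖)]
  exact norm_term_cCoeff_le m s n

/-- The abscissa of absolute convergence of `c_m` is at most `1`. [folklore] -/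
theorem abscissa_cCoeff_le (m : ℕ) : abscissaOfAbsConv (cCoeff m) ≤ 1 :=
  abscissaOfAbsConv_le_of_forall_lt_LSeriesSummable fun y hy ↦
    LSeriesSummable_cCoeff m (by simpa using hy)

/-- `D_m(s) = LSeries c_m s` for `Re s > 1`. [folklore] -/
theorem heckeL_eq_LSeries (m : ℕ) {s : ℂ} (hs : 1 < s.re) : heckeL m s = LSeries (cCoeff m) s :=
  ((LSeriesHasSum_cCoeff m hs).LSeries_eq).symm

/-- `c_m(1) = 4`: the four units, `λ^m(u) = 1`. [folklore] -/
theorem cCoeff_one (m : ℕ) : cCoeff m 1 = 4 := by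
  have h1 : normEq 1 = {1, -1, ⟨0, 1⟩, ⟨0, -1⟩} := by decide
  rw [cCoeff, h1]
  have hu : ∀ u ∈ ({1, -1, ⟨0, 1⟩, ⟨0, -1⟩} : Finset ℤ[i]), angularChar m u = 1 := by
    intro u hu
    refine angularChar_unit m (isUnit_iff_norm_eq_one.mpr ?_)
    simp only [mem_insert, mem_singleton] at hu
    rcases hu with rfl | rfl | rfl | rfl <;> decide
  rw [sum_congr rfl hu, sum_const, nsmul_eq_mul, mul_one]
  have hcard : ({1, -1, ⟨0, 1⟩, ⟨0, -1⟩} : Finset ℤ[i]).card = 4 := by decide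
  rw [hcard]
  norm_num

/-! ### The prime-power series `P_m` and `Q_m` -/

/-- `card (pairsNorm n) ≤ card (normEq n)`: `(π, j) ↦ π^j` is injective on first-quadrant prime
powers (unique factorisation). [folklore] -/
theorem card_pairsNorm_le (n : ℕ) : (pairsNorm n).card ≤ (normEq n).card := by
  refine Finset.card_le_card_of_injOn (fun p ↦ p.1 ^ p.2) (fun p hp ↦ ?_) ?_
  · obtain ⟨hπ, hj, hN⟩ := mem_pairsNorm.mp hp
    rw [Finset.mem_coe, mem_normEq, norm_pow', ← natAbs_norm_cast, ← hN]
    push_cast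
    rfl
  · rintro ⟨π, j⟩ hp ⟨π', j'⟩ hp' (h : π ^ j = π' ^ j')
    obtain ⟨hπ, hj, -⟩ := mem_pairsNorm.mp hp
    obtain ⟨hπ', hj', -⟩ := mem_pairsNorm.mp hp'
    obtain ⟨hP, hQ, -⟩ := mem_primesQ1.mp hπ
    obtain ⟨hP', hQ', -⟩ := mem_primesQ1.mp hπ'
    have hj1 : 1 ≤ j := (mem_Icc.mp hj).1
    have hdvd : π ∣ π' ^ j' := by
      rw [← h]; exact dvd_pow_self π (by omega)
    have hππ' : π = π' :=
      eq_of_associated (hP.associated_of_dvd hP' (hP.dvd_of_dvd_pow hdvd)) hQ hQ'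
    subst hππ'
    have hN2 : 2 ≤ π.norm.natAbs := by
      have h2 : 2 ≤ π.norm := two_le_norm_of_prime hP
      have := natAbs_norm_cast π
      omega
    have hjj : j = j' := by
      have h2 := congrArg (fun z : ℤ[i] ↦ z.norm.natAbs) h
      simp only [norm_pow', Int.natAbs_pow] at h2
      exact Nat.pow_right_injective hN2 h2
    rw [hjj]

/-- `‖l_m(n)‖ ≤ log n · #{x : N(x) = n}`. [folklore] -/
theorem norm_lCoeff_le (m n : ℕ) : ‖lCoeff m n‖ ≤ Real.log n * (normEq n).card := by
  have hlog : ∀ p ∈ pairsNorm n, ‖(Real.log (p.1.norm : ℝ) : ℂ) * angularChar m p.1 ^ p.2‖ ≤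
      Real.log n := by
    intro p hp
    obtain ⟨hπ, hj, hN⟩ := mem_pairsNorm.mp hp
    obtain ⟨hP, -, -⟩ := mem_primesQ1.mp hπ
    have hN1 : (1 : ℝ) ≤ (p.1.norm : ℝ) := by
      have := two_le_norm_of_prime hP
      have h1 : (1 : ℤ) ≤ p.1.norm := by omega
      exact_mod_cast h1
    have hj1 : 1 ≤ p.2 := (mem_Icc.mp hj).1
    rw [norm_mul, norm_pow, norm_angularChar hP.ne_zero, one_pow, mul_one, Complex.norm_real,
      Real.norm_of_nonneg (Real.log_nonneg hN1)]
    have hn : (n : ℝ) = (p.1.norm : ℝ) ^ p.2 := by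
      rw [← hN]; push_cast; rw [natAbs_norm_real]
    rw [hn, Real.log_pow]
    have := Real.log_nonneg hN1
    have hj1' : (1 : ℝ) ≤ p.2 := by exact_mod_cast hj1
    nlinarith
  calc ‖lCoeff m n‖ ≤ ∑ p ∈ pairsNorm n, ‖(Real.log (p.1.norm : ℝ) : ℂ) * angularChar m p.1 ^ p.2‖ :=
        norm_sum_le _ _
    _ ≤ ∑ _p ∈ pairsNorm n, Real.log n := sum_le_sum hlog
    _ = Real.log n * (pairsNorm n).card := by rw [sum_const, nsmul_eq_mul, mul_comm]
    _ ≤ Real.log n * (normEq n).card :=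
        mul_le_mul_of_nonneg_left (by exact_mod_cast card_pairsNorm_le n) (Real.log_natCast_nonneg n)

/-- `c_0(n) = #{x : N(x) = n}`. [folklore] -/
theorem cCoeff_zero (n : ℕ) : cCoeff 0 n = (normEq n).card := by
  simp [cCoeff]

/-- The `L`-series of `l_m` converges absolutely for `Re s > 1` (majorant `log n · c_0(n)`).
[folklore] -/
theorem LSeriesSummable_lCoeff (m : ℕ) {s : ℂ} (hs : 1 < s.re) : LSeriesSummable (lCoeff m) s := by
  have hlog : LSeriesSummable (logMul (cCoeff 0)) s :=
    LSeriesSummable_logMul_of_lt_re ((abscissa_cCoeff_le 0).trans_lt (by exact_mod_cast hs))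
  refine Summable.of_norm_bounded hlog.norm fun n ↦ norm_term_le s ?_
  rw [logMul, norm_mul, cCoeff_zero, Complex.norm_natCast, ← Complex.natCast_log, Complex.norm_real,
    Real.norm_of_nonneg (Real.log_natCast_nonneg n)]
  exact norm_lCoeff_le m n

/-- The abscissa of absolute convergence of `l_m` is at most `1`. [folklore] -/
theorem abscissa_lCoeff_le (m : ℕ) : abscissaOfAbsConv (lCoeff m) ≤ 1 :=
  abscissaOfAbsConv_le_of_forall_lt_LSeriesSummable fun y hy ↦
    LSeriesSummable_lCoeff m (by simpa using hy)

/-- **`P_m(s) = ∑_{π, j ≥ 1} log N(π) λ^m(π)^j N(π)^{-js}`**, the prime-power Dirichlet series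
(`= -D_m'/D_m`), as the `L`-series of `l_m`. [cite: HeckeMathZ1920, §7] -/
def heckeP (m : ℕ) (s : ℂ) : ℂ := LSeries (lCoeff m) s

/-- `q_m(n) = ∑_{(π, j) : N(π)^j = n} j⁻¹ λ^m(π)^j`, the coefficients of `Q_m = log(D_m/4)`.
[folklore] -/
def qCoeff (m n : ℕ) : ℂ := ∑ p ∈ pairsNorm n, angularChar m p.1 ^ p.2 / p.2

/-- `log n · q_m(n) = l_m(n)` (`log N(π)^j = j log N(π)`). [folklore] -/
theorem logMul_qCoeff (m : ℕ) : logMul (qCoeff m) = lCoeff m := by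
  funext n
  rw [logMul, qCoeff, lCoeff, mul_sum]
  refine sum_congr rfl fun p hp ↦ ?_
  obtain ⟨-, hj, hN⟩ := mem_pairsNorm.mp hp
  have hj0 : (p.2 : ℂ) ≠ 0 := by
    have := (mem_Icc.mp hj).1
    exact_mod_cast (show p.2 ≠ 0 by omega)
  have hn : (n : ℝ) = (p.1.norm : ℝ) ^ p.2 := by
    rw [← hN]; push_cast; rw [natAbs_norm_real]
  rw [← Complex.natCast_log, hn, Real.log_pow]
  push_cast
  field_simp

/-- `‖q_m(n)‖ ≤ #{x : N(x) = n}`. [folklore] -/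
theorem norm_qCoeff_le (m n : ℕ) : ‖qCoeff m n‖ ≤ (normEq n).card := by
  have h1 : ∀ p ∈ pairsNorm n, ‖angularChar m p.1 ^ p.2 / (p.2 : ℂ)‖ ≤ 1 := by
    intro p hp
    obtain ⟨hπ, hj, -⟩ := mem_pairsNorm.mp hp
    have hj1 : (1 : ℝ) ≤ p.2 := by exact_mod_cast (mem_Icc.mp hj).1
    rw [norm_div, norm_pow, norm_angularChar (mem_primesQ1.mp hπ).1.ne_zero, one_pow,
      Complex.norm_natCast]
    exact (div_le_one (by linarith)).mpr hj1
  calc ‖qCoeff m n‖ ≤ ∑ p ∈ pairsNorm n, ‖angularChar m p.1 ^ p.2 / (p.2 : ℂ)‖ := norm_sum_le _ _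
    _ ≤ ∑ _p ∈ pairsNorm n, (1 : ℝ) := sum_le_sum h1
    _ = (pairsNorm n).card := by rw [sum_const, nsmul_eq_mul, mul_one]
    _ ≤ (normEq n).card := by exact_mod_cast card_pairsNorm_le n

/-- The `L`-series of `q_m` converges absolutely for `Re s > 1`. [folklore] -/
theorem LSeriesSummable_qCoeff (m : ℕ) {s : ℂ} (hs : 1 < s.re) : LSeriesSummable (qCoeff m) s := by
  refine Summable.of_norm_bounded (LSeriesSummable_cCoeff 0 hs).norm fun n ↦ norm_term_le s ?_
  rw [cCoeff_zero, Complex.norm_natCast]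
  exact norm_qCoeff_le m n

/-- The abscissa of absolute convergence of `q_m` is at most `1`. [folklore] -/
theorem abscissa_qCoeff_le (m : ℕ) : abscissaOfAbsConv (qCoeff m) ≤ 1 :=
  abscissaOfAbsConv_le_of_forall_lt_LSeriesSummable fun y hy ↦
    LSeriesSummable_qCoeff m (by simpa using hy)

/-- **`Q_m(s) = ∑_{π, j ≥ 1} j⁻¹ λ^m(π)^j N(π)^{-js}`** (`= log (D_m(s)/4)`), as the `L`-series of
`q_m`. [cite: HeckeMathZ1920, §7] -/
def heckeQ (m : ℕ) (s : ℂ) : ℂ := LSeries (qCoeff m) s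

/-- `Q_m' = -P_m` on `Re s > 1`. [folklore] -/
theorem hasDerivAt_heckeQ (m : ℕ) {s : ℂ} (hs : 1 < s.re) :
    HasDerivAt (heckeQ m) (-heckeP m s) s := by
  have h := LSeries_hasDerivAt ((abscissa_qCoeff_le m).trans_lt (by exact_mod_cast hs) :
    abscissaOfAbsConv (qCoeff m) < s.re)
  rw [logMul_qCoeff] at h
  exact h

/-! ### `-D_m' = D_m P_m` and `D_m = 4 e^{Q_m}` -/

/-- The open half-plane `Re s > 1` is a neighbourhood of each of its points. [folklore] -/
theorem halfPlane_mem_nhds {s : ℂ} (hs : 1 < s.re) : {z : ℂ | 1 < z.re} ∈ 𝓝 s :=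
  (isOpen_lt continuous_const Complex.continuous_re).mem_nhds hs

/-- **`D_m'(s) = -D_m(s) P_m(s)` for `Re s > 1`** (from the coefficient identity
`c_m ⋆ l_m = log · c_m`, `convolution_cCoeff_lCoeff`). [cite: HeckeMathZ1920, §7] -/
theorem hasDerivAt_heckeL (m : ℕ) {s : ℂ} (hs : 1 < s.re) :
    HasDerivAt (heckeL m) (-(heckeL m s * heckeP m s)) s := by
  have habs : abscissaOfAbsConv (cCoeff m) < s.re :=
    (abscissa_cCoeff_le m).trans_lt (by exact_mod_cast hs)
  have h1 : HasDerivAt (LSeries (cCoeff m)) (-LSeries (logMul (cCoeff m)) s) s :=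
    LSeries_hasDerivAt habs
  have hconv : logMul (cCoeff m) = LSeries.convolution (cCoeff m) (lCoeff m) := by
    funext n
    rw [logMul, convolution_cCoeff_lCoeff, Complex.natCast_log]
  rw [hconv, LSeries_convolution' (LSeriesSummable_cCoeff m hs) (LSeriesSummable_lCoeff m hs),
    ← heckeL_eq_LSeries m hs] at h1
  refine h1.congr_of_eventuallyEq ?_
  filter_upwards [halfPlane_mem_nhds hs] with z hz
  exact heckeL_eq_LSeries m hz

/-- `D_m` is differentiable on `Re s > 1` (also for `m = 0`). [folklore] -/
theorem differentiableAt_heckeL_of_one_lt_re (m : ℕ) {s : ℂ} (hs : 1 < s.re) :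
    DifferentiableAt ℂ (heckeL m) s :=
  (hasDerivAt_heckeL m hs).differentiableAt

/-- `D_m(σ) → c_m(1) = 4` as `σ → +∞`. [folklore] -/
theorem tendsto_heckeL_atTop (m : ℕ) : Tendsto (fun x : ℝ ↦ heckeL m x) atTop (𝓝 4) := by
  have h := LSeries.tendsto_atTop (f := cCoeff m)
    ((abscissa_cCoeff_le m).trans_lt (by exact_mod_cast EReal.coe_lt_top 1))
  rw [cCoeff_one] at h
  refine h.congr' ?_
  filter_upwards [eventually_gt_atTop 1] with x hx
  exact (heckeL_eq_LSeries m (by simpa using hx)).symm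

/-- `Q_m(σ) → q_m(1) = 0` as `σ → +∞`. [folklore] -/
theorem tendsto_heckeQ_atTop (m : ℕ) : Tendsto (fun x : ℝ ↦ heckeQ m x) atTop (𝓝 0) := by
  have h := LSeries.tendsto_atTop (f := qCoeff m)
    ((abscissa_qCoeff_le m).trans_lt (by exact_mod_cast EReal.coe_lt_top 1))
  have h1 : qCoeff m 1 = 0 := by
    rw [qCoeff]
    refine sum_eq_zero fun p hp ↦ ?_
    exfalso
    obtain ⟨hπ, hj, hN⟩ := mem_pairsNorm.mp hp
    have h2 : 2 ≤ p.1.norm.natAbs := by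
      have := two_le_norm_of_prime (mem_primesQ1.mp hπ).1
      have := natAbs_norm_cast p.1
      omega
    have : 2 ≤ p.1.norm.natAbs ^ p.2 :=
      h2.trans (Nat.le_self_pow (by have := (mem_Icc.mp hj).1; omega) _)
    omega
  rwa [h1] at h

/-- **`D_m(s) = 4 exp(Q_m(s))` for `Re s > 1`**: the Euler product of `L(s, λ^m)` in logarithmic
form.  Proof: `D_m e^{-Q_m}` has derivative `(-D_m P_m + D_m P_m) e^{-Q_m} = 0` on the (convex)
half-plane, hence is constant, and tends to `4 · e^0` along the real axis. [cite: HeckeMathZ1920, §7] -/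
theorem heckeL_eq_four_mul_exp (m : ℕ) {s : ℂ} (hs : 1 < s.re) :
    heckeL m s = 4 * Complex.exp (heckeQ m s) := by
  let F : ℂ → ℂ := fun z ↦ heckeL m z * Complex.exp (-heckeQ m z)
  have hderiv : ∀ z : ℂ, 1 < z.re → HasDerivAt F 0 z := by
    intro z hz
    have h1 := hasDerivAt_heckeL m hz
    have h2 := ((hasDerivAt_heckeQ m hz).neg).cexp
    exact (h1.mul h2).congr_deriv (by ring)
  have hconst : ∀ z : ℂ, 1 < z.re → F z = F s := by
    intro z hz
    refine convex_halfSpace_re_gt 1 |>.is_const_of_fderivWithin_eq_zero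
      (fun w hw ↦ (hderiv w hw).differentiableAt.differentiableWithinAt) (fun w hw ↦ ?_) hz hs
    rw [fderivWithin_eq_fderiv (uniqueDiffWithinAt_of_mem_nhds (halfPlane_mem_nhds hw))
      (hderiv w hw).differentiableAt, (hderiv w hw).hasFDerivAt.fderiv]
    ext
    simp
  -- the constant is `4`: let `σ → +∞` along the reals
  have hlim : Tendsto (fun x : ℝ ↦ F x) atTop (𝓝 (4 * Complex.exp (-0))) :=
    (tendsto_heckeL_atTop m).mul ((tendsto_heckeQ_atTop m).neg.cexp)
  have hlim' : Tendsto (fun x : ℝ ↦ F x) atTop (𝓝 (F s)) := by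
    refine tendsto_const_nhds.congr' ?_
    filter_upwards [eventually_gt_atTop 1] with x hx
    exact (hconst x (by simpa using hx)).symm
  have hFs : F s = 4 := by
    have := tendsto_nhds_unique hlim' hlim
    rwa [neg_zero, Complex.exp_zero, mul_one] at this
  have : heckeL m s * Complex.exp (-heckeQ m s) = 4 := hFs
  calc heckeL m s = heckeL m s * Complex.exp (-heckeQ m s) * Complex.exp (heckeQ m s) := by
        rw [mul_assoc, ← Complex.exp_add, neg_add_cancel, Complex.exp_zero, mul_one]
    _ = 4 * Complex.exp (heckeQ m s) := by rw [this]

/-- **`D_m(s) ≠ 0` for `Re s > 1`.** [cite: HeckeMathZ1920, §7] -/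
theorem heckeL_ne_zero_of_one_lt_re (m : ℕ) {s : ℂ} (hs : 1 < s.re) : heckeL m s ≠ 0 := by
  rw [heckeL_eq_four_mul_exp m hs]
  exact mul_ne_zero (by norm_num) (Complex.exp_ne_zero _)

/-- `P_m(s) = -D_m'(s)/D_m(s)` for `Re s > 1`. [folklore] -/
theorem heckeP_eq_neg_deriv_div (m : ℕ) {s : ℂ} (hs : 1 < s.re) :
    heckeP m s = -deriv (heckeL m) s / heckeL m s := by
  rw [(hasDerivAt_heckeL m hs).deriv, neg_neg, mul_div_cancel_left₀ _ (heckeL_ne_zero_of_one_lt_re m hs)]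

/-- `‖D_m(s)‖ = 4 exp(Re Q_m(s))` for `Re s > 1`. [folklore] -/
theorem norm_heckeL_eq (m : ℕ) {s : ℂ} (hs : 1 < s.re) :
    ‖heckeL m s‖ = 4 * Real.exp (heckeQ m s).re := by
  rw [heckeL_eq_four_mul_exp m hs, norm_mul, Complex.norm_exp]
  norm_num

end GaussianHecke

end Literature.NumberTheory.LFunctions
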